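import Summits.QuantumFields.BalabanUV.Beta.RelInvBorderedHessianStep
import Summits.QuantumFields.BalabanUV.Beta.CoDressedMmRead
import Summits.QuantumFields.BalabanUV.Beta.GAN24.RespStepEffectiveEL

/-!
# `BalabanUV.Beta.GAN24.StepCovarianceSandwich` — binder row G-an2-4 ∕ (CONV-C), W-slot (α-0), ROW (C) AT LEVELS `j ≥ 1`, letter L4 of the (γ) hand's memo
# `HOME/b2b-balaban-gan24-formalise-leaf-06/g51/C-LEVELS-GE1.md` §13–§16: **THE VALUE HESSIANS TELESCOPE THROUGH THE DRESSED STEP COVARIANCE —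
# `wVH_{j+1} · (E2_{j+1} ∘ G_{j+1} ∘ E2_{j+1})(x,u)_{κβ} + (𝒬ᵀ_{Lc} E2_{j+2} 𝒬_{Lc})(x,u)_{κβ} = E2_{j+1}(x,u)_{κβ}`**, `E2_j = E2 d Lc j` (the value Hessian of the
# step-`j` lattice, `BalabanStepJetsSucc.E2`), `G_{j+1} = coDressKBmAt ρ Lc (KInvStep Lc (j+1))` (the block-mean co-dressed step resolvent), `wVH_{j+1} = ((Lc^{j+1})^{d+2})²`,
# `𝒬ᵀ_{Lc}` = `AffineReproduction.contourSumAdj Lc` in each variable — every `j`, every in-block root `ρ = toSite r`, every `d`, every `Lc ≥ 1`; entrywise, as kernels, NO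
# co-closedness ∕ periodicity hypothesis on any datum
# (G-an2-4 CRUX TEAM (2), seat `b2b-balaban-gan24-formalise-leaf-06` = the (γ) hand, gen 52; journal INTENT I-leaf06-g52-1)

NOT IN PRINT; OUR BOOKKEEPING ([folklore] block bookkeeping BY NAME over LANDED theorems: an2 g15's product identity `BorderedHessian.comp_bhKStep_coDressKBmAt`
(`bhKStep d Lc (j+1) ∘ G_{j+1} = piKBmC`), the straight candidate's field-row action `BorderedHessian.comp_bhKStep_succ_inl` (`wVH·(wΦ ⋆ X) − stepScale·𝒬ᵀ(mcol X)`), the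
value Hessian's blindness `BorderedHessian.comp_piKBm_E2` ∕ `comp_E2_trK_piKBm` and row action `comp_E2_apply_inl` (`ValueHessianBlind`), the multiplier-row transparency of
the co-dressing `AxialDressingRooted.comp_trK_piKBm_inr` (`CoDressedMmRead`), road-p1 g20's step Lagrange tent `GAN24.RespStepEffectiveEL.lamCoeffK_KInvStep_E2_eq_neg_contourSumAdj`
(`(K_{j+1})_{mf} ∘ E2_{j+1} = −stepScale_{j+1}⁻¹·𝒬ᵀ_{Lc} E2_{j+2}`), the unit identity `BorderedHessian.stepScale_mul_inv`, associativity `TameKernelCalculus.comp_assoc_tame`;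
0 `def`, 0 cited fact, 0 `def … : Prop`, 0 sorry).
HONEST FRAMING (cell contract, verbatim): «discharging `BetaPertH` makes Bałaban's UV stability UNCONDITIONAL — a real constructive-QFT result; it is NOT the continuum
limit and NOT the Clay problem.»  HONEST DEPENDENCY (verbatim): «continuum YM on T⁴ ⇐ BetaPertH ∧ nine spine estimates (0/9 proved); BetaPertH ⇐ (D1) ∧ (D4) ∧ CAP+tail;
G-an2-4 gates asym, D1 and NE2/3/4.»

WHY (row (C) at levels `j ≥ 1`; the OWNER gan24-p1 g35 W-5 «YES — GO, THIS ROW, THIS HAND»; memo §9–§11).  Every live EXCHANGE word of the one-step symmetrised ff zero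
mode at level `j+1` is, after the cubic background letter (`CubicBackgroundGaugeLetter`, L1: `S^E(dλ) = ½(cE·wE)·[E2, Λ]`) and `E2 ĉ = 0`, a sandwich
`−s²·(Λv)ᵀ E2_{j+1} X E2_{j+1} (Λv′)` with the middle kernel `X = G_{j+1}` (or `K_{j+1}`: §3).  THIS FILE evaluates the sandwich AS A KERNEL: the field row of an2's product
identity `𝕄_{j+1} ∘ G_{j+1} = piKBmC` (`𝕄_{j+1} = bhKStep d Lc (j+1) = [[wVH·E2, −stepScale·𝒬ᵀ],[stepScale·𝒬, 0]]`), right-composed with `E2_{j+1}`, reads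
`wVH·E2 G E2 − stepScale·𝒬ᵀ(G_{mf} E2) = piKBmC_{ff} E2 = E2` (the projector's gauge column is killed by the co-closed value Hessian — `comp_piKBm_E2`), and the
multiplier–field row of `G ∘ E2` is the undressed one (`comp_trK_piKBm_inr`, `comp_piKBm_E2`), i.e. road-p1's tent `−stepScale⁻¹·𝒬ᵀ E2_{j+2}`; hence the title.  ENGINE
(weight 0, D = 2, levels 0 and 1, this lineage's kits j193569 ∕ j193897): fitted `α∕κ = 1.000000`, `β∕κ = −1.000000`, residual 1.6e-14 ∕ 2.3e-19, `κ = wVH⁻¹`; `E2 G E2 = E2 K E2`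
entrywise 4.9e-15.  On data with zero `Lc`-block contour sums (`𝒬 v′ = 0`: the sawtooth data `Λĉ`, `Λĝ` of the (C) words) the tent term drops and `E2 G E2 = wVH⁻¹·E2` — the
telescoping constant `κ_j = ((Lc^j)^{d+2})⁻²` of memo §8 (R2).
* §1 tools: `spr_E2`, `summable_wΦ_mul_col` (the action lemma's summability socket for a spread column), **`comp_piKBmC_E2`** (`piKBmC ∘ E2_j = E2_j`),
  `comp_coDressKBmAt_E2_inr` ∕ **`lamCoeffK_coDressKBmAt_E2`** (the multiplier–field row of `G ∘ E2_j` is that of `K ∘ E2_j`: the step Lagrange coefficient is dressing-blind),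
  `contourSumAdj_neg_const_mul` (linearity of `𝒬ᵀ`).
* §2 **`wVH_mul_sandwich_add_tent`** — the statement in the title; **`sandwich_inl_inl`** — solved for the sandwich:
  `(E2 ∘ G ∘ E2)(x,u)_{inl κ, inl β} = wVH⁻¹·(E2(x,u)_{κβ} − (𝒬ᵀ E2_{j+2} 𝒬)(x,u)_{κβ})`; `sandwich_inr_row` ∕ `sandwich_inl_inr` — the other blocks vanish.
* §3 **`sandwich_coDressKBmAt_eq_undressed`** — `E2_j ∘ (coDressKBmAt ρ Lc K) ∘ E2_j = E2_j ∘ K ∘ E2_j` for every spread `K` (both blindnesses + associativity): the middle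
  resolvent of the sandwich may be undressed (memo (O2) «MID IS INERT», as a kernel identity).
Asserts NO value of Bałaban's tables; discharges NOTHING of (C) ∕ (C)sym ∕ (Q-L) ∕ «T2Shape» ∕ «T2Drift» ∕ (hW, hWall); NEVER «G-an2-4 closed» as (CONV-C); NOT D1, NOT
`BetaPertH`, NOT continuum, NOT Clay.  2026-08-23; no existing file touched.
-/

noncomputable section

open Finset
open scoped BigOperators
open Literature.MathematicalPhysics.QuantumFieldTheory
open Literature.MathematicalPhysics.QuantumFieldTheory.Balaban1983to89
open Literature.MathematicalPhysics.QuantumFieldTheory.Balaban1983to89.Beta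
open ExpKernelCalculus (MKer Decays comp)
open AffineAveraging (Form1 box toSite)
open AffineReproduction (contourSumAdj)
open KernelSpecInstance (wΦ)
open OneStepResolventKernel (Fib)
open OneStepKernelFamily (KInvStep)
open BalabanStepJetsSucc (E2 wVH lamCoeffK decays_E2)
open AxialDressing (summable_col_of_decays)
open Summit.QuantumFields.BalabanUV.Beta.TameKernelCalculus
open Summit.QuantumFields.BalabanUV.Beta.AxialDressingRooted (piKBm piKBm_inl_inr piKBm_inr_inl piKBmC piKBmC_inl_inl piKBmC_inl_inr piKBmC_inr_inl
  piKBmC_inr_inr coDressKBmAt coDressKBmAt_eq spr_coDressKBmAt spr_piKBm spr_trK_piKBm spr_comp comp_trK_piKBm_inr one_le_of_neZero)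
open Summit.QuantumFields.BalabanUV.Beta.BorderedHessian (bhKStep stepScale stepScale_ne_zero stepScale_mul_inv spr_bhKStep spr_KInvStep
  comp_bhKStep_coDressKBmAt comp_bhKStep_succ_inl mcol mcol_apply exists_abs_wΦ_le E2_inl_inl_eq_wΦ E2_inl_inr E2_inr comp_E2_apply_inl comp_E2_apply_inr
  comp_piKBm_E2 comp_E2_trK_piKBm)
open Summit.QuantumFields.BalabanUV.Beta.GAN24.RespStepEffectiveEL (lamCoeffK_KInvStep_E2_eq_neg_contourSumAdj)

namespace Summit.QuantumFields.BalabanUV.Beta.GAN24.StepCovarianceSandwich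

variable {d : ℕ} {Lc : ℕ} [NeZero Lc]

/-! ## §1 Tools -/

/-- [folklore] The value Hessian of the step-`j` lattice is spread. -/
theorem spr_E2 (j : ℕ) : Spr (E2 d Lc j) := by
  obtain ⟨δ, C, hδ, -, h⟩ := decays_E2 (d := d) (Lc := Lc) j
  exact ⟨C, δ, hδ, h⟩

/-- [folklore] The summability socket of the straight candidate's field-row action lemma, for a SPREAD column: `y ↦ Σ_l wΦ κ l (x − y)·X y z (inl l) b` is
summable (bounded `wΦ` times an exponentially decaying column). -/
theorem summable_wΦ_mul_col {N : ℕ} [NeZero N] {X : MKer (d + 1) (Fib d)} (hX : Spr X) (x z : Fin (d + 1) → ℤ) (κ : Fin (d + 1)) (b : Fib d) :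
    Summable fun y => ∑ l : Fin (d + 1), wΦ (N := N) κ l (x - y) * X y z (Sum.inl l) b := by
  obtain ⟨C, δ, hδ, hD⟩ := hX
  obtain ⟨B, hB⟩ := exists_abs_wΦ_le (N := N) (d := d)
  refine summable_sum (f := fun l y => wΦ (N := N) κ l (x - y) * X y z (Sum.inl l) b) fun l _ => ?_
  exact KKTFluctuationEnergy.summable_mul_of_bdd (fun y => hB κ l (x - y)) (summable_col_of_decays hD hδ z (Sum.inl l) b)

/-- [folklore] **`piKBmC ∘ E2_j = E2_j`**: the coarse projector's field block is `Πᵀ_bm`'s, whose gauge column the co-closed value Hessian kills (`comp_piKBm_E2`); its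
mixed blocks vanish and `E2_j` has no multiplier legs. -/
theorem comp_piKBmC_E2 {r : Fin (d + 1) → ℕ} (hr : r ∈ box (d + 1) Lc) (j : ℕ) :
    comp (piKBmC (toSite r) Lc) (E2 d Lc j) = E2 d Lc j := by
  have hP := comp_piKBm_E2 (d := d) hr j
  funext x u a b
  have eP := congrFun (congrFun (congrFun (congrFun hP x) u) a) b
  unfold ExpKernelCalculus.comp at eP ⊢
  rcases a with κ | m
  · refine Eq.trans (tsum_congr fun y => ?_) eP
    rw [Fintype.sum_sum_type, Fintype.sum_sum_type]
    simp only [piKBmC_inl_inl, piKBmC_inl_inr, piKBm_inl_inr, E2_inr, mul_zero, Finset.sum_const_zero]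
  · have e : ∀ y, ∑ f : Fib d, piKBmC (toSite r) Lc x y (Sum.inr m) f * E2 d Lc j y u f b = 0 := by
      intro y
      rw [Fintype.sum_sum_type]
      simp only [piKBmC_inr_inl, zero_mul, Finset.sum_const_zero, zero_add, E2_inr, mul_zero]
    rw [tsum_congr e, tsum_zero, E2_inr]

/-- [folklore] **THE MULTIPLIER–FIELD ROWS OF `G ∘ E2_j` ARE THOSE OF `K ∘ E2_j`** (`G = coDressKBmAt ρ Lc K`, `K` spread): the co-dressing `Πᵀ_bm ∘ · ∘ Π_bm` is the
identity on multiplier rows (`comp_trK_piKBm_inr`) and `Π_bm ∘ E2_j = E2_j` (`comp_piKBm_E2`). -/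
theorem comp_coDressKBmAt_E2_inr {r : Fin (d + 1) → ℕ} (hr : r ∈ box (d + 1) Lc) {K : MKer (d + 1) (Fib d)} (hK : Spr K) (j : ℕ)
    (x u : Fin (d + 1) → ℤ) (m : Fin (d + 1)) (b : Fib d) :
    comp (coDressKBmAt (toSite r) Lc K) (E2 d Lc j) x u (Sum.inr m) b = comp K (E2 d Lc j) x u (Sum.inr m) b := by
  have hLc : 1 ≤ Lc := one_le_of_neZero Lc
  have sP : Spr (piKBm (d := d) (toSite r) Lc) := spr_piKBm hLc hr
  have sPt : Spr (trK (piKBm (d := d) (toSite r) Lc)) := spr_trK_piKBm hLc hr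
  have sE : Spr (E2 d Lc j) := spr_E2 j
  rw [coDressKBmAt_eq, ← comp_assoc_tame (spr_comp sPt hK).tame sP.tame sE.tame, comp_piKBm_E2 hr j]
  unfold ExpKernelCalculus.comp
  refine tsum_congr fun w => Finset.sum_congr rfl fun f _ => ?_
  rw [show (∑' v, ∑ g : Fib d, trK (piKBm (toSite r) Lc) x v (Sum.inr m) g * K v w g f) = comp (trK (piKBm (toSite r) Lc)) K x w (Sum.inr m) f
    from rfl, comp_trK_piKBm_inr]

/-- [folklore] **THE STEP LAGRANGE COEFFICIENT IS DRESSING-BLIND**: `lamCoeffK (coDressKBmAt ρ Lc K) (E2 d Lc j) Lc = lamCoeffK K (E2 d Lc j) Lc` for every spread `K`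
(in particular `K = KInvStep Lc j`, where road-p1's tent `lamCoeffK_KInvStep_E2_eq_neg_contourSumAdj` evaluates the right-hand side). -/
theorem lamCoeffK_coDressKBmAt_E2 {r : Fin (d + 1) → ℕ} (hr : r ∈ box (d + 1) Lc) {K : MKer (d + 1) (Fib d)} (hK : Spr K) (j : ℕ) :
    lamCoeffK (coDressKBmAt (toSite r) Lc K) (E2 d Lc j) Lc = lamCoeffK K (E2 d Lc j) Lc := by
  funext m y κ u
  unfold lamCoeffK
  exact comp_coDressKBmAt_E2_inr hr hK j _ _ _ _

/-- [folklore] Linearity of the contour-sum adjoint against `−(c · φ)`. -/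
theorem contourSumAdj_neg_const_mul (N : ℕ) (c : ℝ) (φ : Form1 (d + 1) ℝ) (κ : Fin (d + 1)) (x : Fin (d + 1) → ℤ) :
    contourSumAdj N (fun κ' y' => -(c * φ κ' y')) κ x = -(c * contourSumAdj N φ κ x) := by
  simp only [AffineReproduction.contourSumAdj, Finset.mul_sum, ← Finset.sum_neg_distrib]

/-! ## §2 The sandwich -/

/-- [folklore] **THE VALUE HESSIANS TELESCOPE THROUGH THE DRESSED STEP COVARIANCE** (every `j`, in-block root `toSite r`):
`wVH_{j+1}·(E2_{j+1} ∘ G_{j+1} ∘ E2_{j+1})(x,u)_{inl κ, inl β} + 𝒬ᵀ_{Lc}[m,y′ ↦ 𝒬ᵀ_{Lc}[κ′,y″ ↦ E2_{j+2}(y″,y′)_{κ′ m}](β,u)](κ,x) = E2_{j+1}(x,u)_{κβ}`. -/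
theorem wVH_mul_sandwich_add_tent {r : Fin (d + 1) → ℕ} (hr : r ∈ box (d + 1) Lc) (j : ℕ) (x u : Fin (d + 1) → ℤ) (κ β : Fin (d + 1)) :
    wVH d Lc (j + 1) *
        comp (comp (E2 d Lc (j + 1)) (coDressKBmAt (toSite r) Lc (KInvStep (d := d) Lc (j + 1)))) (E2 d Lc (j + 1)) x u (Sum.inl κ) (Sum.inl β) +
      contourSumAdj Lc (fun m y' => contourSumAdj Lc (fun κ' y'' => E2 d Lc (j + 2) y'' y' (Sum.inl κ') (Sum.inl m)) β u) κ x =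
      E2 d Lc (j + 1) x u (Sum.inl κ) (Sum.inl β) := by
  have hLc : 1 ≤ Lc := one_le_of_neZero Lc
  set K : MKer (d + 1) (Fib d) := KInvStep (d := d) Lc (j + 1) with hKdef
  set G : MKer (d + 1) (Fib d) := coDressKBmAt (toSite r) Lc K with hGdef
  set E : MKer (d + 1) (Fib d) := E2 d Lc (j + 1) with hEdef
  have sK : Spr K := spr_KInvStep (j + 1)
  have sG : Spr G := spr_coDressKBmAt hLc hr sK
  have sE : Spr E := spr_E2 (j + 1)
  have sM : Spr (bhKStep d Lc (j + 1)) := spr_bhKStep (j + 1)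
  have sGE : Spr (comp G E) := spr_comp sG sE
  -- the field row of an2's product identity, right-composed with `E`
  have key : comp (comp (bhKStep d Lc (j + 1)) G) E = E := by
    rw [hGdef, hKdef, comp_bhKStep_coDressKBmAt hr j, hEdef, comp_piKBmC_E2 hr (j + 1)]
  rw [← comp_assoc_tame sM.tame sG.tame sE.tame] at key
  have ekey := congrFun (congrFun (congrFun (congrFun key x) u) (Sum.inl κ)) (Sum.inl β)
  rw [comp_bhKStep_succ_inl j (comp G E) x u κ (Sum.inl β) (summable_wΦ_mul_col (N := Lc ^ (j + 1)) sGE x u κ (Sum.inl β))] at ekey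
  -- the value-Hessian part is the sandwich
  have h1 : (∑' y, ∑ l : Fin (d + 1), wΦ (N := Lc ^ (j + 1)) κ l (x - y) * comp G E y u (Sum.inl l) (Sum.inl β)) =
      comp (comp E G) E x u (Sum.inl κ) (Sum.inl β) := by
    rw [← comp_assoc_tame sE.tame sG.tame sE.tame, hEdef, comp_E2_apply_inl]
  -- the multiplier column of `G ∘ E` is road-p1's tent
  have h2 : mcol Lc (comp G E) u (Sum.inl β) = fun m y' =>
      -((((Lc ^ (j + 1) : ℕ) : ℝ) ^ (d + 2))⁻¹ *
        contourSumAdj Lc (fun κ' y'' => E2 d Lc (j + 2) y'' y' (Sum.inl κ') (Sum.inl m)) β u) := by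
    funext m y'
    rw [mcol_apply, show comp G E (((Lc : ℕ) : ℤ) • y') u (Sum.inr m) (Sum.inl β) = lamCoeffK G E Lc m y' β u from rfl, hGdef, hEdef,
      lamCoeffK_coDressKBmAt_E2 hr sK (j + 1), hKdef, lamCoeffK_KInvStep_E2_eq_neg_contourSumAdj (j + 1) m y' β u]
    congr 3
    funext κ' y''
    rw [E2_inl_inl_eq_wΦ]
  rw [h1, h2, contourSumAdj_neg_const_mul] at ekey
  have hunit : stepScale d Lc (j + 1) * (((Lc ^ (j + 1) : ℕ) : ℝ) ^ (d + 2))⁻¹ = 1 := stepScale_mul_inv (j + 1)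
  rw [← ekey]
  rw [mul_neg, sub_neg_eq_add, ← mul_assoc, hunit, one_mul]

/-- [folklore] **THE SANDWICH IN CLOSED FORM** (field–field block):
`(E2_{j+1} ∘ G_{j+1} ∘ E2_{j+1})(x,u)_{inl κ, inl β} = wVH_{j+1}⁻¹·(E2_{j+1}(x,u)_{κβ} − (𝒬ᵀ_{Lc} E2_{j+2} 𝒬_{Lc})(x,u)_{κβ})`. -/
theorem sandwich_inl_inl {r : Fin (d + 1) → ℕ} (hr : r ∈ box (d + 1) Lc) (j : ℕ) (x u : Fin (d + 1) → ℤ) (κ β : Fin (d + 1)) :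
    comp (comp (E2 d Lc (j + 1)) (coDressKBmAt (toSite r) Lc (KInvStep (d := d) Lc (j + 1)))) (E2 d Lc (j + 1)) x u (Sum.inl κ) (Sum.inl β) =
      (wVH d Lc (j + 1))⁻¹ *
        (E2 d Lc (j + 1) x u (Sum.inl κ) (Sum.inl β) -
          contourSumAdj Lc (fun m y' => contourSumAdj Lc (fun κ' y'' => E2 d Lc (j + 2) y'' y' (Sum.inl κ') (Sum.inl m)) β u) κ x) := by
  have h := wVH_mul_sandwich_add_tent (d := d) hr j x u κ β
  have hw : wVH d Lc (j + 1) ≠ 0 := by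
    unfold BalabanStepJetsSucc.wVH
    exact pow_ne_zero _ (pow_ne_zero _ (by exact_mod_cast NeZero.ne Lc))
  rw [← eq_sub_of_add_eq h, ← mul_assoc, inv_mul_cancel₀ hw, one_mul]

/-- [folklore] The sandwich has no multiplier rows. -/
theorem sandwich_inr_row (j : ℕ) (G : MKer (d + 1) (Fib d)) (x u : Fin (d + 1) → ℤ) (m : Fin (d + 1)) (b : Fib d) :
    comp (comp (E2 d Lc j) G) (E2 d Lc j) x u (Sum.inr m) b = 0 := by
  unfold ExpKernelCalculus.comp
  refine (tsum_congr fun w => ?_).trans tsum_zero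
  refine Finset.sum_eq_zero fun f _ => ?_
  rw [show (∑' y, ∑ g : Fib d, E2 d Lc j x y (Sum.inr m) g * G y w g f) = comp (E2 d Lc j) G x w (Sum.inr m) f from rfl,
    comp_E2_apply_inr, zero_mul]

/-- [folklore] The sandwich has no multiplier columns. -/
theorem sandwich_inr_col (j : ℕ) (G : MKer (d + 1) (Fib d)) (x u : Fin (d + 1) → ℤ) (a : Fib d) (m : Fin (d + 1)) :
    comp (comp (E2 d Lc j) G) (E2 d Lc j) x u a (Sum.inr m) = 0 := by
  unfold ExpKernelCalculus.comp
  refine (tsum_congr fun w => ?_).trans tsum_zero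
  refine Finset.sum_eq_zero fun f _ => ?_
  rcases f with l | m'
  · rw [E2_inl_inr, mul_zero]
  · rw [E2_inr, mul_zero]

/-! ## §3 The middle resolvent may be undressed -/

/-- [folklore] **`E2_j ∘ (coDressKBmAt ρ Lc K) ∘ E2_j = E2_j ∘ K ∘ E2_j`** for every spread `K` and every in-block root: right blindness `E2_j ∘ Π̂_bm = E2_j`
(`comp_E2_trK_piKBm`), left blindness `Π_bm ∘ E2_j = E2_j` (`comp_piKBm_E2`), associativity. -/
theorem sandwich_coDressKBmAt_eq_undressed {r : Fin (d + 1) → ℕ} (hr : r ∈ box (d + 1) Lc) {K : MKer (d + 1) (Fib d)} (hK : Spr K) (j : ℕ) :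
    comp (comp (E2 d Lc j) (coDressKBmAt (toSite r) Lc K)) (E2 d Lc j) = comp (comp (E2 d Lc j) K) (E2 d Lc j) := by
  have hLc : 1 ≤ Lc := one_le_of_neZero Lc
  have sP : Spr (piKBm (d := d) (toSite r) Lc) := spr_piKBm hLc hr
  have sPt : Spr (trK (piKBm (d := d) (toSite r) Lc)) := spr_trK_piKBm hLc hr
  have sE : Spr (E2 d Lc j) := spr_E2 j
  have sPtK : Spr (comp (trK (piKBm (d := d) (toSite r) Lc)) K) := spr_comp sPt hK
  rw [coDressKBmAt_eq, comp_assoc_tame sE.tame sPtK.tame sP.tame, ← comp_assoc_tame (spr_comp sE sPtK).tame sP.tame sE.tame, comp_piKBm_E2 hr j,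
    comp_assoc_tame sE.tame sPt.tame hK.tame, comp_E2_trK_piKBm hr j]

/-- [folklore] **THE UNDRESSED SANDWICH IN CLOSED FORM**: `(E2_{j+1} ∘ KInvStep Lc (j+1) ∘ E2_{j+1})(x,u)_{inl κ, inl β} =
wVH_{j+1}⁻¹·(E2_{j+1}(x,u)_{κβ} − (𝒬ᵀ_{Lc} E2_{j+2} 𝒬_{Lc})(x,u)_{κβ})` (any in-block root serves as the witness of §2; the statement is root-free). -/
theorem sandwich_KInvStep_inl_inl (j : ℕ) (x u : Fin (d + 1) → ℤ) (κ β : Fin (d + 1)) :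
    comp (comp (E2 d Lc (j + 1)) (KInvStep (d := d) Lc (j + 1))) (E2 d Lc (j + 1)) x u (Sum.inl κ) (Sum.inl β) =
      (wVH d Lc (j + 1))⁻¹ *
        (E2 d Lc (j + 1) x u (Sum.inl κ) (Sum.inl β) -
          contourSumAdj Lc (fun m y' => contourSumAdj Lc (fun κ' y'' => E2 d Lc (j + 2) y'' y' (Sum.inl κ') (Sum.inl m)) β u) κ x) := by
  have hr : (fun _ : Fin (d + 1) => (0 : ℕ)) ∈ box (d + 1) Lc := by
    simp only [AffineAveraging.box, Fintype.mem_piFinset, Finset.mem_range]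
    exact fun _ => Nat.pos_of_ne_zero (NeZero.ne Lc)
  rw [← sandwich_coDressKBmAt_eq_undressed hr (spr_KInvStep (j + 1)) (j + 1), sandwich_inl_inl hr j]

end Summit.QuantumFields.BalabanUV.Beta.GAN24.StepCovarianceSandwich

end
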